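import Summits.QuantumFields.BalabanUV.Beta.SymSliceProjectorFixed
import Summits.QuantumFields.BalabanUV.Beta.FP.BlockMeanProjectorGrad
import Summits.QuantumFields.BalabanUV.Beta.AxialDressingRootedBmKernel

/-!
# `BalabanUV.Beta.D1BFx.SymBmAbsorbsBm` — road «BF-x» for binder row D1, junction (J1): **THE (III′) SYMMETRISED BLOCK-MEAN DRESSING ABSORBS THE
# BLOCK-MEAN DRESSING**, `Π̂^{sym}_bm ∘ Π_bm = Π̂^{sym}_bm` (ANY two roots), hence `coDressKSymAt ρc N (coDressKBmAt ρ N K) = coDressKSymAt ρc N K`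
# (unit `b2b-balaban-beta-d1-p2`, gen 21 — road OWNER; located in Q-g21-1 ∕ an2 g42 R-D1-g42-1 (a))

HONEST DEPENDENCY (page 1, mandatory): continuum YM on T⁴ ⇐ BetaPertH ∧ nine spine estimates (0/9 proved); BetaPertH ⇐ (D1) ∧ (D4) ∧ CAP+tail;
G-an2-4 gates asym, D1 and NE2/3/4.  HONEST FRAMING (cell contract, verbatim): «discharging `BetaPertH` makes Bałaban's UV stability UNCONDITIONAL — a real
constructive-QFT result; it is NOT the continuum limit and NOT the Clay problem.»  THIS FILE: [folklore] Form-level and kernel bookkeeping over OUR projectors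
(an2's `axProjBmAt` ∕ `symAxProjBmAt` ∕ `piKBm` ∕ `piKSymBm` ∕ `coDressKBmAt` ∕ `coDressKSymAt`); nothing of Bałaban's asserted; 0 root-level binders of row D1
discharged; (K) NOT closed; NOT D1, NOT BetaPertH, NOT continuum, NOT Clay.

WHY.  Both `Π_bm = axProjBmAt ρ N` and `Π̂^{sym}_bm = symAxProjBmAt ρc N` are of the form `A ↦ A − grad g(A)` with `g(A)` of ZERO BLOCK MEAN (`bmGaugeAt`,
`symBmGaugeAt`), and `Π̂^{sym}_bm` KILLS every pure gauge with a parameter of zero block mean (d1-p3 g14's `FP.BlockMeanProjectorGrad.symAxProjBmAt_grad_eq_zero_of_blockMean_zero`);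
so `Π̂^{sym}_bm (Π_bm A) = Π̂^{sym}_bm A − Π̂^{sym}_bm (grad (bmGaugeAt ρ A N)) = Π̂^{sym}_bm A` — for ANY pair of roots.  At kernel level (`piKBm` ∕ `piKSymBm`
represent the transposed projectors, `AxialDressingRootedBmKernel` ∕ `SymmetrisedDressingKernel`): `comp (piKBm (toSite r) N) (piKSymBm (toSite rc) N) = piKSymBm (toSite rc) N`
and its `trK`; hence the symmetrised co-dressing of a block-mean co-dressed kernel is the symmetrised co-dressing of the kernel.  CONSEQUENCE (next file, (J1)): the
(III′) leg `GcombSh n 0 = coDressKAt ρc (coDressKSymAt ρc (KInvStep n 0))` EQUALS `coDressKAt ρc (coDressKSymAt ρc (G₀^{bm}))` for the road's leg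
`G₀^{bm} = coDressKBmAt (toSite r) n (KInvStep n 0)`, so the spine's one-shot kernel at the literal of record `JcOf` IS `hessKer G₀^{bm} (vertexOfK G₀^{bm} n S) W`
with `S, W` the DRESSED literal's jets (an2's `hessKer_dressSymAt` ∕ `hessKer_dressAt` at `K := G₀^{bm}`) — (J1) EXACT at the Π_bm leg, no re-leg, no invariance row.
ABSOLUTE RULE (cell charter, verbatim): «No internally-minted statement may enter as a cited fact. Every hypothesis is either kernel-proved in this package or a
verbatim quotation of a PUBLISHED theorem with page reference. The manuscript(s) under audit are NOT citable for their own disputed steps — they are the thing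
under adjudication; programme-internal (2001/route/tribunal) claims are never citable.»  No `def`, no `def … : Prop`, nothing cited; 0 sorry.
-/

noncomputable section

namespace Summit.QuantumFields.BalabanUV.Beta.D1BFx.SymBmAbsorbsBm

open Finset
open scoped BigOperators
open Literature.MathematicalPhysics.QuantumFieldTheory
open Literature.MathematicalPhysics.QuantumFieldTheory.Balaban1983to89
open Literature.MathematicalPhysics.QuantumFieldTheory.Balaban1983to89.Beta
open ExpKernelCalculus (MKer comp)
open AffineAveraging (Form0 Form1 Site box toSite)
open AveragingContours (blk grad)
open OneStepResolventKernel (Fib)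
open Summit.QuantumFields.BalabanUV.Beta.TameKernelCalculus
open Summit.QuantumFields.BalabanUV.Beta.AxialDressingRooted
open Summit.QuantumFields.BalabanUV.Beta.AxialProjectorBlockMean (blockMeanAt bmGaugeAt axProjBmAt)
open Summit.QuantumFields.BalabanUV.Beta.SymmetrisedAxialGaugeBlockMean (symAxProjBmAt)
open Summit.QuantumFields.BalabanUV.Beta.SymmetrisedDressingMatrix (bondIndR pmSymBm)
open Summit.QuantumFields.BalabanUV.Beta.SymmetrisedDressingKernel (piKSymBm piKSymBm_inl_inl_eq piKSymBm_inl_inr piKSymBm_inr_inl piKSymBm_inr_inr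
  coDressKSymAt coDressKSymAt_eq spr_piKSymBm spr_trK_piKSymBm comp_piKSymBm_inr)
open Summit.QuantumFields.BalabanUV.Beta.SymSliceProjectorFixed (symAxProjBmAt_add symAxProjBmAt_smul symAxProjBmAt_sum_smul eq_sum_window_bondIndR)
open Summit.QuantumFields.BalabanUV.Beta.FP.BlockMeanProjectorGrad (symAxProjBmAt_grad_eq_zero_of_blockMean_zero)

variable {d : ℕ}

/-! ## §1 Form level: `Π̂^{sym}_bm ∘ Π_bm = Π̂^{sym}_bm` -/

/-- [folklore] The block-mean-normalised tree gauge has ZERO BLOCK MEAN (`N ≥ 1`): `blockMeanAt N (bmGaugeAt ρ A N) = 0`. -/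
theorem blockMeanAt_bmGaugeAt {N : ℕ} (hN : 1 ≤ N) (ρ : Fin (d + 1) → ℤ) (A : Form1 (d + 1) ℝ) :
    blockMeanAt N (bmGaugeAt ρ A N) = 0 := by
  funext x
  have hbb : blockMeanAt N (blockMeanAt N (AveragingContoursRooted.treeGaugeAt ρ A N)) x
      = blockMeanAt N (AveragingContoursRooted.treeGaugeAt ρ A N) x :=
    BorderedHessian.blockMeanAt_blockConst' hN (fun b => AffineAveraging.blockSum N (AveragingContoursRooted.treeGaugeAt ρ A N) b / ((N : ℝ) ^ (d + 1))) x
  show blockMeanAt N (AveragingContoursRooted.treeGaugeAt ρ A N - blockMeanAt N (AveragingContoursRooted.treeGaugeAt ρ A N)) x = 0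
  rw [BorderedHessian.blockMeanAt_sub, Pi.sub_apply, hbb, sub_self]

/-- [folklore] **`Π̂^{sym}_bm ∘ Π_bm = Π̂^{sym}_bm` AT ANY TWO ROOTS** (`N ≥ 1`): the symmetrised block-mean projector kills `grad (bmGaugeAt ρ A N)`. -/
theorem symAxProjBmAt_axProjBmAt {N : ℕ} (hN : 1 ≤ N) (ρc : Site (d + 1)) (ρ : Fin (d + 1) → ℤ) (A : Form1 (d + 1) ℝ) :
    symAxProjBmAt ρc N (axProjBmAt ρ N A) = symAxProjBmAt ρc N A := by
  have hsplit : axProjBmAt ρ N A = A + (-1 : ℝ) • grad (bmGaugeAt ρ A N) := by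
    unfold axProjBmAt
    rw [neg_one_smul, sub_eq_add_neg]
  rw [hsplit, symAxProjBmAt_add, symAxProjBmAt_smul, symAxProjBmAt_grad_eq_zero_of_blockMean_zero hN ρc (blockMeanAt_bmGaugeAt hN ρ A),
    smul_zero, add_zero]

/-! ## §2 Kernel level: `comp piKBm piKSymBm = piKSymBm`, `comp (trK piKSymBm) (trK piKBm) = trK piKSymBm` -/

section Kernel

variable {N : ℕ} {r rc : Fin (d + 1) → ℕ}

/-- [folklore] The row of `piKBm` at `(x, inl α)` is the 1-form `Π_bm δ_{(α,x)}` (in-block root): `piKBm (toSite r) N x y (inl α) (inl γ) = (Π_bm (bondIndR α x)) γ y`. -/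
theorem piKBm_inl_inl_eq_bondIndR (hN : 1 ≤ N) (hr : r ∈ box (d + 1) N) (x y : Fin (d + 1) → ℤ) (α γ : Fin (d + 1)) :
    piKBm (toSite r) N x y (Sum.inl α) (Sum.inl γ) = axProjBmAt (toSite r) N (bondIndR α x) γ y := by
  rw [piKBm_inl_inl]
  split_ifs with h
  · rfl
  · by_contra hne
    exact h (window_of_pmBm_ne_zero hN hr (Ne.symm hne))

/-- [folklore] **FIELD BLOCK**: `(piKBm ∘ piKSymBm)(x,α; x′,β) = (Π̂^{sym}_bm (Π_bm δ_{(α,x)}))_β(x′) = (Π̂^{sym}_bm δ_{(α,x)})_β(x′) = piKSymBm(x,α; x′,β)`. -/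
theorem comp_piKBm_piKSymBm_inl_inl (hN : 1 ≤ N) (hr : r ∈ box (d + 1) N) (hrc : rc ∈ box (d + 1) N)
    (x x' : Fin (d + 1) → ℤ) (α β : Fin (d + 1)) :
    comp (piKBm (toSite r) N) (piKSymBm (toSite rc) N) x x' (Sum.inl α) (Sum.inl β) = piKSymBm (toSite rc) N x x' (Sum.inl α) (Sum.inl β) := by
  classical
  unfold ExpKernelCalculus.comp
  -- the fibre sum at `y`: windowed
  have h : ∀ y, ∑ f : Fib d, piKBm (toSite r) N x y (Sum.inl α) f * piKSymBm (toSite rc) N y x' f (Sum.inl β) =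
      if y - x ∈ cube (d + 1) N then
        ∑ γ : Fin (d + 1), axProjBmAt (toSite r) N (bondIndR α x) γ y * symAxProjBmAt (toSite rc) N (bondIndR γ y) β x' else 0 := by
    intro y
    rw [Fintype.sum_sum_type]
    simp only [piKSymBm_inr_inl, mul_zero, Finset.sum_const_zero, add_zero]
    by_cases hy : y - x ∈ cube (d + 1) N
    · rw [if_pos hy]
      refine Finset.sum_congr rfl fun γ _ => ?_
      rw [piKBm_inl_inl_eq_bondIndR hN hr, piKSymBm_inl_inl_eq hN hrc]
      rfl
    · rw [if_neg hy]
      refine Finset.sum_eq_zero fun γ _ => ?_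
      rw [piKBm_inl_inl, if_neg hy, zero_mul]
  simp_rw [h]
  rw [tsum_window]
  -- the window sum is `Π̂^{sym}_bm` of the window expansion of the row `Π_bm δ_{(α,x)}`
  have hsupp : ∀ γ y, axProjBmAt (toSite r) N (bondIndR α x) γ y ≠ 0 → y - x ∈ cube (d + 1) N := fun γ y hne =>
    window_of_pmBm_ne_zero hN hr hne
  have hexp := eq_sum_window_bondIndR (N := N) hsupp
  have key : symAxProjBmAt (toSite rc) N (axProjBmAt (toSite r) N (bondIndR α x)) β x'
      = ∑ p ∈ cube (d + 1) N ×ˢ (Finset.univ : Finset (Fin (d + 1))),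
          axProjBmAt (toSite r) N (bondIndR α x) p.2 (x + p.1) * symAxProjBmAt (toSite rc) N (bondIndR p.2 (x + p.1)) β x' := by
    conv_lhs => rw [hexp]
    rw [symAxProjBmAt_sum_smul]
  rw [Finset.sum_product] at key
  rw [← key, symAxProjBmAt_axProjBmAt hN, piKSymBm_inl_inl_eq hN hrc]
  rfl

/-- [folklore] **`comp (piKBm (toSite r) N) (piKSymBm (toSite rc) N) = piKSymBm (toSite rc) N`** — `Π̂^{sym}_bm` ABSORBS `Π_bm` at kernel level (any two
in-block roots; the multiplier rows∕columns are identities). -/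
theorem comp_piKBm_piKSymBm (hN : 1 ≤ N) (hr : r ∈ box (d + 1) N) (hrc : rc ∈ box (d + 1) N) :
    comp (piKBm (toSite r) N) (piKSymBm (toSite rc) N) = piKSymBm (d := d) (toSite rc) N := by
  classical
  funext x x' a b
  rcases b with β | m'
  · rcases a with α | m
    · exact comp_piKBm_piKSymBm_inl_inl hN hr hrc x x' α β
    · -- a multiplier ROW of `piKBm` is the identity row
      unfold ExpKernelCalculus.comp
      have h : ∀ y, ∑ f : Fib d, piKBm (toSite r) N x y (Sum.inr m) f * piKSymBm (toSite rc) N y x' f (Sum.inl β) =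
          if x = y then piKSymBm (toSite rc) N y x' (Sum.inr m) (Sum.inl β) else 0 := by
        intro y
        rw [Fintype.sum_sum_type]
        simp only [piKBm_inr_inl, zero_mul, Finset.sum_const_zero, zero_add, piKBm_inr_inr]
        by_cases hx : x = y
        · simp only [hx, true_and, ite_mul, one_mul, zero_mul, Finset.sum_ite_eq, Finset.mem_univ, if_true]
        · simp [hx]
      simp_rw [h]
      rw [tsum_point]
  · rw [comp_piKSymBm_inr]
    rcases a with α | m
    · rw [piKBm_inl_inr, piKSymBm_inl_inr]
    · rw [piKBm_inr_inr, piKSymBm_inr_inr]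

/-- [folklore] … transposed: **`comp (trK (piKSymBm (toSite rc) N)) (trK (piKBm (toSite r) N)) = trK (piKSymBm (toSite rc) N)`**. -/
theorem comp_trK_piKSymBm_trK_piKBm (hN : 1 ≤ N) (hr : r ∈ box (d + 1) N) (hrc : rc ∈ box (d + 1) N) :
    comp (trK (piKSymBm (toSite rc) N)) (trK (piKBm (toSite r) N)) = trK (piKSymBm (d := d) (toSite rc) N) := by
  rw [← trK_comp, comp_piKBm_piKSymBm hN hr hrc]

/-! ## §3 The co-dressings: `coDressKSymAt ρc (coDressKBmAt ρ K) = coDressKSymAt ρc K` -/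

/-- [folklore] **THE SYMMETRISED BLOCK-MEAN CO-DRESSING OF A BLOCK-MEAN CO-DRESSED KERNEL IS THE SYMMETRISED CO-DRESSING OF THE KERNEL** (any two in-block roots;
`K` spread): `coDressKSymAt ρc N (coDressKBmAt ρ N K) = coDressKSymAt ρc N K` — §2 on both sides + tame associativity. -/
theorem coDressKSymAt_coDressKBmAt (hN : 1 ≤ N) (hr : r ∈ box (d + 1) N) (hrc : rc ∈ box (d + 1) N) {K : MKer (d + 1) (Fib d)} (hK : Spr K) :
    coDressKSymAt (toSite rc) N (coDressKBmAt (toSite r) N K) = coDressKSymAt (toSite rc) N K := by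
  have tS : Tame (piKSymBm (toSite rc) N) := (spr_piKSymBm hN hrc).tame
  have tSt : Tame (trK (piKSymBm (toSite rc) N)) := (spr_trK_piKSymBm hN hrc).tame
  have tB : Tame (piKBm (toSite r) N) := (spr_piKBm hN hr).tame
  have tBt : Tame (trK (piKBm (toSite r) N)) := (spr_trK_piKBm hN hr).tame
  have tK : Tame K := hK.tame
  have tBtK : Tame (comp (trK (piKBm (toSite r) N)) K) := (ChartConjugationRelative.spr_comp (spr_trK_piKBm hN hr) hK).tame
  have tG : Tame (coDressKBmAt (toSite r) N K) := (spr_coDressKBmAt hN hr hK).tame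
  have tStK : Tame (comp (trK (piKSymBm (toSite rc) N)) K) := (ChartConjugationRelative.spr_comp (spr_trK_piKSymBm hN hrc) hK).tame
  rw [coDressKSymAt_eq, coDressKSymAt_eq, coDressKBmAt_eq]
  -- `Sᵀ ((Bᵀ K) B) S = ((Sᵀ (Bᵀ K)) B) S = (((Sᵀ Bᵀ) K) B) S = ((Sᵀ K) B) S = (Sᵀ K) (B S) = (Sᵀ K) S`
  rw [comp_assoc_tame tSt tBtK tB, comp_assoc_tame tSt tBt tK, comp_trK_piKSymBm_trK_piKBm hN hr hrc,
    ← comp_assoc_tame tStK tB tS, comp_piKBm_piKSymBm hN hr hrc]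

end Kernel

end Summit.QuantumFields.BalabanUV.Beta.D1BFx.SymBmAbsorbsBm

end
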